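import Summits.Ventures.Crystal3D.Theorems.StickyWulffConstantTextureBuildTentLine
import HarnessLib

/-!
# TB-1 (tiling identity, part 3): the SHARP tent line and THE CRUST LINE — phantom continuations are paid by the crust's own half-defects («slack = gain»)
# (lane T, crux `TextureLiminfV5`, stmt-Ventures-23912; `stub_textureBuild` → TB-0.md §8; cf-p1 DECISION (cxxv) «Mesh v2 = CrustCell, §73.8»)

HONEST FRAMING. Venture `Summits/Ventures/Crystal3D` (cell `crystal3d-full`), route `route-Ventures-StickyWulffConstant`, helper `--supports` the
law-v5 crux `TextureLiminfV5` (stmt-Ventures-23912).  Pure finite combinatorics (census-free, standard axioms); no adhesion law is proved — the T-FORM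
adhesion inequality enters as a HYPOTHESIS (`hadh`); rung F-C1 not moved.

WHAT.
* `brokenNearIn_le_sum_halfDefect_sharp` — the tent line of …TextureBuildTentLine WITH the phantom-neighbour credit kept:
  `brokenNearIn S Xh U ≤ Σ_{owned} 2·hd_{X′} + cross(owned, X′∖Xh) − cross(owned, Xh∖X′) + Σ_{phantoms near U} (12 − cdeg Xh)` (owned = real tent balls near `U`;
  a phantom site adjacent to an owned ball is NOT a broken bond, and the lossy line forgot that credit).
* **`crustLine`** — for host lattice balls `P`, an off-tent crust `B ⊆ X′ ∖ Xh`, phantoms `Q ⊆ Xh ∖ X′` with `P ⊆ Xh ∩ X′`, and the T-FORM ADHESION INEQUALITY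
  `cross(P,B) ≤ D(B) + (cross(P,Q) − D(Q)) + A` (TB-0.md §8; `A` = the law's rim `C·ρ`):
  `Σ_{q∈Q} (12 − cdeg Xh q) − cross(P,Q) + cross(P,B) ≤ 2·Σ_{b∈B} hd_{X′} b + cross(B, X′ ∖ (B ∪ P)) + 2A`
  — the phantom sites' vacant counts and the host–crust bonds that the tent over-charges are paid by the crust balls' own half-defects, up to the crust's
  bonds leaving the cell and the law's rim.  (§8 shows the same bookkeeping does NOT close with the slab form of `stub_barlowAdhesionR`.)
WHAT THIS IS NOT: no cover, no texture, no adhesion law; F-C1 not moved.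
-/

noncomputable section

namespace Summit.Ventures.Crystal3D.Theorems

open Finset Summit.Ventures.Crystal3D
open Literature.MathematicalPhysics.StatisticalMechanics (IsHaggSeq contactDeficiency)
open Summit.Ventures.Crystal3D.Cruxes.TextureLiminf.TexShadow (E3 stacking brokenNearIn)

/-! ## The sharp tent line -/

/-- Degrees split exactly along `Xh = (Xh ∩ X′) ∪ (Xh ∖ X′)` and `X′ = (Xh ∩ X′) ∪ (X′ ∖ Xh)`:
`12 − cdeg Xh a = (12 − cdeg X′ a) + #{X′∖Xh-nbrs} − #{Xh∖X′-nbrs}`. -/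
theorem twelve_sub_cdeg_eq (Xh X' : Finset E3) (a : E3) :
    (12 : ℝ) - (cdeg Xh a : ℝ) = ((12 : ℝ) - (cdeg X' a : ℝ)) + (((X' \ Xh).filter fun q => dist a q = 1).card : ℝ) -
      (((Xh \ X').filter fun q => dist a q = 1).card : ℝ) := by
  classical
  have h1 : cdeg Xh a = cdeg (Xh ∩ X') a + ((Xh \ X').filter fun q => dist a q = 1).card := by
    have := cdeg_eq_add_sdiff (Finset.inter_subset_left (s₁ := Xh) (s₂ := X')) a
    rw [show Xh \ (Xh ∩ X') = Xh \ X' by ext q; simp [Finset.mem_sdiff]] at this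
    exact this
  have h2 : cdeg X' a = cdeg (Xh ∩ X') a + ((X' \ Xh).filter fun q => dist a q = 1).card := by
    have := cdeg_eq_add_sdiff (Finset.inter_subset_right (s₁ := Xh) (s₂ := X')) a
    rw [show X' \ (Xh ∩ X') = X' \ Xh by ext q; simp [Finset.mem_sdiff]] at this
    exact this
  have h1' : (cdeg Xh a : ℝ) = (cdeg (Xh ∩ X') a : ℝ) + (((Xh \ X').filter fun q => dist a q = 1).card : ℝ) := by exact_mod_cast h1
  have h2' : (cdeg X' a : ℝ) = (cdeg (Xh ∩ X') a : ℝ) + (((X' \ Xh).filter fun q => dist a q = 1).card : ℝ) := by exact_mod_cast h2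
  linarith

open scoped Classical in
/-- **THE SHARP TENT LINE**: `brokenNearIn S Xh U ≤ Σ_{owned} 2·halfDefect X′ + crossCount owned (X′ ∖ Xh) − crossCount owned (Xh ∖ X′) + Σ_{phantoms near U} (12 − cdeg Xh)`
(owned = real tent balls within `√2` of `U`; in fact an equality). -/
theorem brokenNearIn_le_sum_halfDefect_sharp {L : E3 ≃ₗᵢ[ℝ] E3} {s : E3} {σ : ℤ → ℤ} (hσ : IsHaggSeq σ)
    {Xh : Finset E3} (hXh : (↑Xh : Set E3) ⊆ stacking L s σ) (X' : Finset E3) (U : Set E3) :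
    (brokenNearIn (stacking L s σ) Xh U : ℝ) ≤
      ∑ a ∈ (Xh ∩ X').filter (fun a => Metric.infDist a U ≤ Real.sqrt 2), 2 * halfDefect X' a +
        (crossCount ((Xh ∩ X').filter (fun a => Metric.infDist a U ≤ Real.sqrt 2)) (X' \ Xh) : ℝ) -
        (crossCount ((Xh ∩ X').filter (fun a => Metric.infDist a U ≤ Real.sqrt 2)) (Xh \ X') : ℝ) +
        ∑ a ∈ (Xh \ X').filter (fun a => Metric.infDist a U ≤ Real.sqrt 2), ((12 : ℝ) - (cdeg Xh a : ℝ)) := by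
  rw [brokenNearIn_eq_sum_twelve_sub_cdeg hσ hXh U]
  have hsplit : Xh.filter (fun a => Metric.infDist a U ≤ Real.sqrt 2) =
      (Xh ∩ X').filter (fun a => Metric.infDist a U ≤ Real.sqrt 2) ∪
        (Xh \ X').filter (fun a => Metric.infDist a U ≤ Real.sqrt 2) := by
    rw [← Finset.filter_union, Finset.union_comm, Finset.sdiff_union_inter]
  have hdisj : Disjoint ((Xh ∩ X').filter (fun a => Metric.infDist a U ≤ Real.sqrt 2))
      ((Xh \ X').filter (fun a => Metric.infDist a U ≤ Real.sqrt 2)) :=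
    Finset.disjoint_filter_filter (by
      rw [Finset.disjoint_left]; intro q hq hq'
      exact (Finset.mem_sdiff.1 hq').2 (Finset.mem_inter.1 hq).2)
  rw [hsplit, Finset.sum_union hdisj, crossCount_eq_sum, crossCount_eq_sum, Nat.cast_sum, Nat.cast_sum]
  have hreal : ∑ a ∈ (Xh ∩ X').filter (fun a => Metric.infDist a U ≤ Real.sqrt 2), ((12 : ℝ) - (cdeg Xh a : ℝ)) =
      ∑ a ∈ (Xh ∩ X').filter (fun a => Metric.infDist a U ≤ Real.sqrt 2), 2 * halfDefect X' a +
        ∑ a ∈ (Xh ∩ X').filter (fun a => Metric.infDist a U ≤ Real.sqrt 2), ((((X' \ Xh).filter fun q => dist a q = 1).card : ℕ) : ℝ) -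
        ∑ a ∈ (Xh ∩ X').filter (fun a => Metric.infDist a U ≤ Real.sqrt 2), ((((Xh \ X').filter fun q => dist a q = 1).card : ℕ) : ℝ) := by
    rw [← Finset.sum_add_distrib, ← Finset.sum_sub_distrib]
    refine Finset.sum_congr rfl fun a _ => ?_
    have h := twelve_sub_cdeg_eq Xh X' a
    have h2 : 2 * halfDefect X' a = (12 : ℝ) - (cdeg X' a : ℝ) := by unfold halfDefect; ring
    linarith
  linarith

/-! ## The crust line -/

/-- Phantom sites see at least their `Q`- and `P`-neighbours inside the tent set: for `Q, P ⊆ Xh` disjoint,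
`Σ_{q∈Q} (12 − cdeg Xh q) ≤ 2·D(Q) − crossCount Q P`. -/
theorem sum_twelve_sub_cdeg_le_of_subset {Xh P Q : Finset E3} (hP : P ⊆ Xh) (hQ : Q ⊆ Xh) (hPQ : Disjoint P Q) :
    ∑ q ∈ Q, ((12 : ℝ) - (cdeg Xh q : ℝ)) ≤ 2 * contactDeficiency Q - (crossCount Q P : ℝ) := by
  classical
  rw [two_mul_contactDeficiency_eq_sum, crossCount_eq_sum, Nat.cast_sum, ← Finset.sum_sub_distrib]
  refine Finset.sum_le_sum fun q _ => ?_
  -- `cdeg Q q + cdeg P q ≤ cdeg Xh q`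
  have hle : cdeg Q q + cdeg P q ≤ cdeg Xh q := by
    unfold cdeg
    rw [← Finset.card_union_of_disjoint (Finset.disjoint_filter_filter hPQ.symm), ← Finset.filter_union]
    exact Finset.card_le_card (Finset.filter_subset_filter _ (Finset.union_subset hQ hP))
  have hle' : (cdeg Q q : ℝ) + (cdeg P q : ℝ) ≤ (cdeg Xh q : ℝ) := by exact_mod_cast hle
  unfold cdeg at hle' ⊢
  linarith

/-- **THE CRUST LINE** (TB-0.md §8, «slack = gain»).  Host lattice balls `P ⊆ Xh ∩ X′`, crust `B ⊆ X′ ∖ Xh`, phantoms `Q ⊆ Xh ∖ X′`, and the T-FORM adhesion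
inequality `crossCount P B ≤ D(B) + (crossCount P Q − D(Q)) + A`.  Then
`Σ_{q∈Q} (12 − cdeg Xh q) − crossCount P Q + crossCount P B ≤ 2·Σ_{b∈B} halfDefect X′ b + crossCount B (X′ ∖ (B ∪ P)) + 2A`. -/
theorem crustLine {Xh X' P B Q : Finset E3} (hPXh : P ⊆ Xh) (hPX' : P ⊆ X') (hB : B ⊆ X' \ Xh) (hQ : Q ⊆ Xh \ X')
    {A : ℝ} (hadh : (crossCount P B : ℝ) ≤ contactDeficiency B + ((crossCount P Q : ℝ) - contactDeficiency Q) + A) :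
    ∑ q ∈ Q, ((12 : ℝ) - (cdeg Xh q : ℝ)) - (crossCount P Q : ℝ) + (crossCount P B : ℝ) ≤
      2 * ∑ b ∈ B, halfDefect X' b + (crossCount B (X' \ (B ∪ P)) : ℝ) + 2 * A := by
  classical
  have hQXh : Q ⊆ Xh := fun q hq => (Finset.mem_sdiff.1 (hQ hq)).1
  have hBX' : B ⊆ X' := fun b hb => (Finset.mem_sdiff.1 (hB hb)).1
  have hPQ : Disjoint P Q := by
    rw [Finset.disjoint_left]; intro a haP haQ
    exact (Finset.mem_sdiff.1 (hQ haQ)).2 (hPX' haP)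
  have hPB : Disjoint B P := by
    rw [Finset.disjoint_left]; intro a haB haP
    exact (Finset.mem_sdiff.1 (hB haB)).2 (hPXh haP)
  -- phantoms
  have h1 := sum_twelve_sub_cdeg_le_of_subset hPXh hQXh hPQ
  -- the crust's standalone deficiency in half-defect currency
  have h2 : contactDeficiency B = ∑ b ∈ B, halfDefect X' b + (crossCount B (X' \ B) : ℝ) / 2 :=
    contactDeficiency_eq_sum_halfDefect_add_cross hBX'
  have h3 : crossCount B (X' \ B) = crossCount B P + crossCount B (X' \ (B ∪ P)) := by
    have hsplit : X' \ B = P ∪ X' \ (B ∪ P) := by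
      ext q
      simp only [Finset.mem_sdiff, Finset.mem_union, not_or]
      constructor
      · intro ⟨hq, hqB⟩
        by_cases hqP : q ∈ P
        · exact Or.inl hqP
        · exact Or.inr ⟨hq, hqB, hqP⟩
      · rintro (hqP | ⟨hq, hqB, -⟩)
        · exact ⟨hPX' hqP, fun hqB => Finset.disjoint_left.1 hPB hqB hqP⟩
        · exact ⟨hq, hqB⟩
    rw [hsplit, crossCount_union_right B (by
      rw [Finset.disjoint_left]; intro q hqP hq
      exact (Finset.mem_sdiff.1 hq).2 (Finset.mem_union_right _ hqP))]
  have h3' : (crossCount B (X' \ B) : ℝ) = (crossCount B P : ℝ) + (crossCount B (X' \ (B ∪ P)) : ℝ) := by exact_mod_cast h3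
  have h4 : crossCount B P = crossCount P B := crossCount_comm B P
  have h4' : (crossCount B P : ℝ) = (crossCount P B : ℝ) := by exact_mod_cast h4
  have h5 : crossCount Q P = crossCount P Q := crossCount_comm Q P
  have h5' : (crossCount Q P : ℝ) = (crossCount P Q : ℝ) := by exact_mod_cast h5
  rw [h2, h3', h4'] at hadh
  rw [h5'] at h1
  linarith

end Summit.Ventures.Crystal3D.Theorems

end
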